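/-
Copyright (c) 2026 the pub-hodgecm-mathlib formalisation cell (harness21).  Prover seat hodgecm-mathlib-K2E4-p23 (g2), Track B ∕ K2-LIT, h413 =
`stmt-HodgeConjecture-24833`, ENGINE E1, 5Res campaign «ENDGAME BY FAMILIES», RUNG 1 (M1 atoms), deal (262) of K2E1-plan (g7): the M1 ATOMS SKELETON —
`hatoms` at the trivial `K_∞`-type and a finite level `K′_f` (M1: `K′_f = K_max,f`) for `U(H)(𝔸_{L⁺})`, every plugged letter BY NAME, the in-flight ones as VISIBLE SOCKETS.
-/
import Summits.HodgeConjecture.HodgeConjecture.Theorems.K2E1ResidualPartInAtomsCMTwo        -- ★ p860658∕p860688∕p860758 (this seat): `hD5_of_letters`, `hPEis_of_letters`, `hEisdef_of_trivial_kType`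
import Summits.HodgeConjecture.HodgeConjecture.Theorems.K2E1BlockProjectorFixesVectorsU       -- ★ p860649 (K2E2-p12): `cm_blockProjector_hPfix`
import Summits.HodgeConjecture.HodgeConjecture.Theorems.K2E1ResidualEisExhaustionCMTwo         -- ★ p860760 (K2E4-p14): `hEXH_of_generators`
import HarnessLib

/-!
# K2·E1 — `K2E1ResidualAtomsMaximalLevelCMTwo`: THE M1 ATOMS SKELETON — `hatoms` AT (τ = 1, level `K′_f`) FOR `U(H)(𝔸_{L⁺})`, SOCKETS VISIBLE
# (RUNG 1 of the 5Res ladder, deal (262): «(L²_res)^{K_∞·K_max,f} is finite-dimensional» is K2E4-p14's TOP applied to THIS head at `N = 2`, `H = J₂`, `K′_f = K_max,f`)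

Track B ∕ K2-LIT, crux h413 = `stmt-HodgeConjecture-24833`, route of record `HCCMUnconditional`; cell `hodgecm-mathlib`, squad K2, ENGINE E1.  Prover seat `hodgecm-mathlib-K2E4-p23` (g2);
deal (262).  THEOREMS ONLY (no `def`, no `instance`, no notation, no named-fact hypothesis, no `sorry`); lane `--supports stmt-HodgeConjecture-24833 --as helper`
(count-neutral).  CLOSES NO SOCKET.  Stated for `cmDatum L N H` (every `N`, `H`); the M1 instance is `quasiSplit L⁺ L c 2 = cmDatum L 2 ((StdForm.antidiagonal 2).over L)` (★ `quasiSplit_eq_cmDatum`, `rfl`).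

CURRENCY.  `π = R` on `L²(μ)`; trivial `K_∞`-type: `χ : C_c(K, ℂ)` with `hχ1 : χ ≡ 1` (so `P_χ` is the `κ(K)`-average); level `K′ ≤ G(𝔸_f)` with its normalised idempotent `e` (`he0 he1 heK hestar`,
★ `exists_hebe`); the block projector `P = P_1 ∘L R_f(e)` (binder `hPdef`); `Kad := closure (ι_∞κ(K) ∪ ι_f(K′))` (the adelic level `K_∞ · K′_f`); K2E1-p10's
`Eis := (L²_cusp(𝔓))ᗮ ⊓ (R|_{Kad})-invariants`; `𝔓` EXPLICIT (∀-guarded: junk data cannot help — the consumer names `cmParabolicData`∕its transport); blocks `b : S` (`[Finite S]`, M1: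
`S = S(K_max)` of ★ adapter p860699) with generating sets `gen b ⊆ L²` and coordinates `V b : L² →ₗ A_b × L²(Ω_b; E_b)` injective on the closed block; `U b := V b ∘ P_{closure span gen b}`.
PLUGGED ★ BY NAME: `hPfix` (★ p860649 `cm_blockProjector_hPfix`, `χ ≡ 1`), `hPEis` (★ `hPEis_of_letters` ∘ ★ `hEisdef_of_trivial_kType`, `hKad := le_rfl`), `hD5` (★ `hD5_of_letters`), `hEXH`
(★ `hEXH_of_generators`), glue (★ `hatoms_of_noLineMass` via ★ `hatoms_of_letters`).
VISIBLE SOCKETS (one in-flight payer each): **(S-C7)** `hC7 : Eis ≤ closure ⨆_b closure span (gen b)` (NAMED C7 head at `K′ = Kad`, K2E1-p10); **(S-V)** `hV` injectivity of `V b` on the block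
(OD: ★ p860754 isometry ∘ ★ modelMap; SD: K2E1-p14∕(y1) package); **(S-β)** the per-block letters of ★ (β) for `U b`: `T b ∕ hT𝓐 ∕ hTP ∕ hTB` (★ p860650 + hcommTau ★ p860595),
`s b ∕ hs ∕ hU` (OD ★ p860634 + ★ p860609; SD (y1)), `hline` (★ p860608 ∘ ★ p860525).
* §1 `hχmul_of_one`, `hχone_of_one`, `hχinv_of_one` (the character letters at `χ ≡ 1`), `hPfix_trivialKType` (★ p860649 at `χ ≡ 1`, K2E4-p14's abstract `(ιK, ιa, ιf, χ₀, U₀) :=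
  (id, ι_∞ ∘ κ, ι_f, 1, K′)`).
* §2 **`hatoms_trivialKType_of_sockets`** — the `hatoms` clause of ★ `levelFinite_of_atoms` at `(1, K′)`: `∃ P′ A′, FiniteDimensional A′ ∧ (fix-clause) ∧ ∀ W irreducible ≤ L²_res(𝔓), P′ w ∈ A′`.
HONEST LABEL: HC_CM is proved only modulo the 7 printed citations (2 remaining named inputs: hLiu418 = `stmt-HodgeConjecture-24832`, h413 = `stmt-HodgeConjecture-24833`) until rung 0
closes; this file asserts no named fact, is conditional by construction on the visible sockets, and closes no socket; count-neutral; RUNG 1 (M1 atoms) ≠ 5Res.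

## References
* [MoeglinWaldspurger1995] C. Mœglin, J.-L. Waldspurger, *Spectral decomposition and Eisenstein series* (1995), I.2.18, II.1.4, IV.3.12, V.3.13, VI.2.
* [BorelJacquet1979] A. Borel, H. Jacquet, PSPM 33.1 (1979), §4.1, §4.6.
* [DeitmarEchterhoff2014] A. Deitmar, S. Echterhoff, *Principles of Harmonic Analysis* (2014), Lemma 1.6.3.
-/

set_option autoImplicit false
-- the mandated namespace repeats the single-problem summit's segment (`HodgeConjecture.HodgeConjecture`)
set_option linter.dupNamespace false

noncomputable section

open MeasureTheory Filter Topology CompactlySupported NumberField ContRepresentation Set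
open scoped InnerProductSpace ENNReal ComplexConjugate
open Literature.NumberTheory.Automorphic Literature.NumberTheory.Automorphic.UnitaryGroup AdelicGroupData
open Summit.HodgeConjecture.HodgeConjecture.Cruxes.H413.K2E1ResidualPartInAtomsCMTwo (hD5_of_letters hPEis_of_letters hEisdef_of_trivial_kType)
open Summit.HodgeConjecture.HodgeConjecture.Cruxes.H413.K2E1ResidueAtomsOfNoLineMassU (hatoms_of_noLineMass)
open Summit.HodgeConjecture.HodgeConjecture.Cruxes.H413.K2E1BlockProjectorFixesVectorsU (cm_blockProjector_hPfix)
open Summit.HodgeConjecture.HodgeConjecture.Cruxes.H413.K2E1ResidualEisExhaustionCMTwo (hEXH_of_generators)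
open Summit.HodgeConjecture.HodgeConjecture.Cruxes.H413.K2E1CuspidalSpectrumUnitary

namespace Summit.HodgeConjecture.HodgeConjecture.Cruxes.H413.K2E1ResidualAtomsMaximalLevelCMTwo

variable {L : Type} [Field L] [NumberField L] [IsCMField L] {N : ℕ} {H : Matrix (Fin N) (Fin N) L}
  (μ : Measure (cmDatum L N H).automorphicQuotient) [(cmDatum L N H).IsAutomorphicMeasure μ]
  {K : Type*} [Group K] [TopologicalSpace K] [MeasurableSpace K] [BorelSpace K]
  [MeasurableSpace (UnitaryGroup.arch (↥(maximalRealSubfield L)) L (IsCMField.complexConj L) N H)] [BorelSpace (UnitaryGroup.arch (↥(maximalRealSubfield L)) L (IsCMField.complexConj L) N H)]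
  [MeasurableSpace (finAdelic (↥(maximalRealSubfield L)) L (IsCMField.complexConj L) N H)] [BorelSpace (finAdelic (↥(maximalRealSubfield L)) L (IsCMField.complexConj L) N H)]
  (νinf : Measure (UnitaryGroup.arch (↥(maximalRealSubfield L)) L (IsCMField.complexConj L) N H)) [IsFiniteMeasureOnCompacts νinf] [νinf.IsMulLeftInvariant] [νinf.IsInvInvariant] [νinf.IsOpenPosMeasure]
  (νf : Measure (finAdelic (↥(maximalRealSubfield L)) L (IsCMField.complexConj L) N H)) [IsFiniteMeasureOnCompacts νf] [νf.IsMulLeftInvariant] [νf.IsInvInvariant] [νf.IsOpenPosMeasure]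
  (κ : K →* UnitaryGroup.arch (↥(maximalRealSubfield L)) L (IsCMField.complexConj L) N H) (hκ : Continuous κ)
  (μK : Measure K) [IsFiniteMeasureOnCompacts μK] [IsProbabilityMeasure μK] [MeasurableMul K] [μK.IsMulLeftInvariant] [MeasurableInv K] [μK.IsInvInvariant]
  (χ : C_c(K, ℂ)) (e : C_c(finAdelic (↥(maximalRealSubfield L)) L (IsCMField.complexConj L) N H, ℂ))

/-! ## §1 The letters at the trivial `K_∞`-type -/

omit [TopologicalSpace K] [MeasurableSpace K] [MeasurableMul K] [MeasurableInv K] in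
/-- `χ ≡ 1` is multiplicative. [folklore] -/
theorem hχmul_of_one (χ₁ : K → ℂ) (hχ1 : ∀ k, χ₁ k = 1) : ∀ k l, χ₁ (k * l) = χ₁ k * χ₁ l := fun k l => by rw [hχ1, hχ1, hχ1, one_mul]

omit [TopologicalSpace K] [MeasurableSpace K] [MeasurableMul K] [MeasurableInv K] in
/-- `χ ≡ 1` satisfies `conj (χ k⁻¹) = χ k`. [folklore] -/
theorem hχinv_of_one (χ₁ : K → ℂ) (hχ1 : ∀ k, χ₁ k = 1) : ∀ k, conj (χ₁ k⁻¹) = χ₁ k := fun k => by rw [hχ1, hχ1, map_one]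

omit [MeasurableSpace (UnitaryGroup.arch (↥(maximalRealSubfield L)) L (IsCMField.complexConj L) N H)] [BorelSpace (UnitaryGroup.arch (↥(maximalRealSubfield L)) L (IsCMField.complexConj L) N H)]
  [νf.IsMulLeftInvariant] [νf.IsInvInvariant] [νf.IsOpenPosMeasure] [μK.IsMulLeftInvariant] [μK.IsInvInvariant] [MeasurableMul K] [MeasurableInv K] in
/-- **`hPfix` AT THE TRIVIAL `K_∞`-TYPE** (★ p860649 with `χ ≡ 1`): the block projector `P = P_1 ∘L R_f(e)` fixes every vector that is `K′`-invariant under the finite factor and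
`κ(K)`-invariant under the archimedean one — the fix-clause of ★ `hatoms_of_noLineMass` with `(ιK, ιa, ιf, χ₀, U₀) := (id, ι_∞ ∘ κ, ι_f, 1, K′)`. [cite: BorelJacquet1979, §4.1] -/
theorem hPfix_trivialKType (hχ1 : ∀ k, χ k = 1)
    (K' : Subgroup (finAdelic (↥(maximalRealSubfield L)) L (IsCMField.complexConj L) N H)) (hK'o : IsOpen (K' : Set (finAdelic (↥(maximalRealSubfield L)) L (IsCMField.complexConj L) N H))) (he0 : ∀ x, x ∉ K' → e x = 0) (he1 : ∫ x, e x ∂νf = 1)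
    (P : (cmDatum L N H).L2 μ →L[ℂ] (cmDatum L N H).L2 μ) (hPdef : P = ((((cmDatum L N H).rightRegular μ).restrict ((archToAdelic (↥(maximalRealSubfield L)) L (IsCMField.complexConj L) N H).comp κ)).integratedOperator (((cmDatum L N H).isUnitary_rightRegular μ).restrict _)
          (((cmDatum L N H).isStronglyContinuous_rightRegular_holds μ).restrict _ ((continuous_archToAdelic (↥(maximalRealSubfield L)) L (IsCMField.complexConj L) N H).comp hκ)) μK χ ∘L
        (((cmDatum L N H).rightRegular μ).restrict (finAdelicToAdelic (↥(maximalRealSubfield L)) L (IsCMField.complexConj L) N H)).integratedOperator (((cmDatum L N H).isUnitary_rightRegular μ).restrict _) (((cmDatum L N H).isStronglyContinuous_rightRegular_holds μ).restrict _ (continuous_finAdelicToAdelic (↥(maximalRealSubfield L)) L (IsCMField.complexConj L) N H)) νf e)) :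
    ∀ x : (cmDatum L N H).L2 μ, (∀ u ∈ (⟨K', hK'o⟩ : OpenSubgroup (finAdelic (↥(maximalRealSubfield L)) L (IsCMField.complexConj L) N H)), ((cmDatum L N H).rightRegular μ) ((MonoidHom.id (cmDatum L N H).Adelic) ((finAdelicToAdelic (↥(maximalRealSubfield L)) L (IsCMField.complexConj L) N H) u)) x = x) →
      (∀ t : K, ((cmDatum L N H).rightRegular μ) ((MonoidHom.id (cmDatum L N H).Adelic) (((archToAdelic (↥(maximalRealSubfield L)) L (IsCMField.complexConj L) N H).comp κ) t)) x = (1 : K →* ℂ) t • x) → P x = x := by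
  intro x hxU hxχ
  subst hPdef
  refine cm_blockProjector_hPfix ((cmDatum L N H).rightRegular μ) ((cmDatum L N H).isUnitary_rightRegular μ) ((cmDatum L N H).isStronglyContinuous_rightRegular_holds μ) νf κ hκ μK χ e (hχmul_of_one χ hχ1) (hχ1 1) K' he0 he1 x (fun u hu => hxU u hu) fun k => ?_
  rw [hχ1, one_smul]
  have h := hxχ k
  rwa [MonoidHom.one_apply, one_smul] at h

/-! ## §2 The M1 atoms skeleton -/

/-- **`hatoms` AT (τ = 1, LEVEL `K′_f`) FROM THE VISIBLE SOCKETS** — RUNG 1's skeleton.  Plugged ★: `hPfix` (§1), `hPEis` (★ `hPEis_of_letters` ∘ ★ `hEisdef_of_trivial_kType` with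
`Kad := closure (ι_∞κ(K) ∪ ι_f(K′))`), `hEXH` (★ `hEXH_of_generators`), `hD5` (★ `hD5_of_letters`), glue (★ `hatoms_of_noLineMass`).  Sockets: (S-C7) `hC7`, (S-V) `hV`, (S-β) the
per-block letters `T∕hT𝓐∕hTP∕hTB`, `s∕hs∕hU`, `hline` for `U b := V b ∘ P_{closure span gen b}`.  CONCLUSION: the `hatoms` clause of ★ `levelFinite_of_atoms` at `(1, K′)` with K2E4-p14's
abstract `(ιK, ιa, ιf) := (id, ι_∞ ∘ κ, ι_f)`. [cite: MoeglinWaldspurger1995, I.2.18, V.3.13, VI.2] [cite: BorelJacquet1979, §4.6] -/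
theorem hatoms_trivialKType_of_sockets [MeasurableMul (finAdelic (↥(maximalRealSubfield L)) L (IsCMField.complexConj L) N H)] [ENNReal.HolderTriple ∞ 2 2] (hχ1 : ∀ k, χ k = 1)
    (K' : Subgroup (finAdelic (↥(maximalRealSubfield L)) L (IsCMField.complexConj L) N H)) (hK'o : IsOpen (K' : Set (finAdelic (↥(maximalRealSubfield L)) L (IsCMField.complexConj L) N H))) (he0 : ∀ x, x ∉ K' → e x = 0) (he1 : ∫ x, e x ∂νf = 1)
    (heK : ∀ k ∈ K', ∀ x, e (k * x) = e x) (hestar : ∀ x, mulStar (⇑e) x = e x)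
    (P : (cmDatum L N H).L2 μ →L[ℂ] (cmDatum L N H).L2 μ) (hPdef : P = ((((cmDatum L N H).rightRegular μ).restrict ((archToAdelic (↥(maximalRealSubfield L)) L (IsCMField.complexConj L) N H).comp κ)).integratedOperator (((cmDatum L N H).isUnitary_rightRegular μ).restrict _)
          (((cmDatum L N H).isStronglyContinuous_rightRegular_holds μ).restrict _ ((continuous_archToAdelic (↥(maximalRealSubfield L)) L (IsCMField.complexConj L) N H).comp hκ)) μK χ ∘L
        (((cmDatum L N H).rightRegular μ).restrict (finAdelicToAdelic (↥(maximalRealSubfield L)) L (IsCMField.complexConj L) N H)).integratedOperator (((cmDatum L N H).isUnitary_rightRegular μ).restrict _) (((cmDatum L N H).isStronglyContinuous_rightRegular_holds μ).restrict _ (continuous_finAdelicToAdelic (↥(maximalRealSubfield L)) L (IsCMField.complexConj L) N H)) νf e))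
    (𝔓 : (cmDatum L N H).ParabolicUnipotentData)
    -- the blocks, their coordinates, (S-V) and (S-C7)
    {S : Type*} [Finite S] (gen : S → Set ((cmDatum L N H).L2 μ))
    {A : S → Type*} [∀ b, AddCommGroup (A b)] [∀ b, Module ℂ (A b)] [∀ b, FiniteDimensional ℂ (A b)]
    {Ω : S → Type*} {mΩ : ∀ b, MeasurableSpace (Ω b)} (m : ∀ b, Measure (Ω b)) {E : S → Type*} [∀ b, NormedAddCommGroup (E b)] [∀ b, NormedSpace ℂ (E b)]
    (V : ∀ b, (cmDatum L N H).L2 μ →ₗ[ℂ] (A b × Lp (E b) 2 (m b)))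
    (hV : ∀ b, ∀ y ∈ (Submodule.span ℂ (gen b)).topologicalClosure, V b y = 0 → y = 0)
    (hC7 : (((cmDatum L N H).cuspidalSubspace μ 𝔓).toSubmoduleᗮ ⊓ ((((cmDatum L N H).rightRegular μ)).restrict (Subgroup.closure (Set.range (fun k : K => (archToAdelic (↥(maximalRealSubfield L)) L (IsCMField.complexConj L) N H) (κ k)) ∪ (finAdelicToAdelic (↥(maximalRealSubfield L)) L (IsCMField.complexConj L) N H) '' (K' : Set (finAdelic (↥(maximalRealSubfield L)) L (IsCMField.complexConj L) N H)))).subtype).invariants) ≤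
      (⨆ b, (Submodule.span ℂ (gen b)).topologicalClosure).topologicalClosure)
    -- (S-β): the per-block letters of ★ (β) for `U b := V b ∘ P_{closure span gen b}`
    (Jb : S → Type*) [∀ b, Countable (Jb b)]
    (T : ∀ b, Jb b → (cmDatum L N H).L2 μ →L[ℂ] (cmDatum L N H).L2 μ) (hT𝓐 : ∀ b j, T b j ∈ {A' : (cmDatum L N H).L2 μ →L[ℂ] (cmDatum L N H).L2 μ | ∃ (a : C_c(UnitaryGroup.arch (↥(maximalRealSubfield L)) L (IsCMField.complexConj L) N H, ℂ)) (b : C_c(finAdelic (↥(maximalRealSubfield L)) L (IsCMField.complexConj L) N H, ℂ)),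
      A' = (((cmDatum L N H).rightRegular μ).restrict (archToAdelic (↥(maximalRealSubfield L)) L (IsCMField.complexConj L) N H)).integratedOperator (((cmDatum L N H).isUnitary_rightRegular μ).restrict _) (((cmDatum L N H).isStronglyContinuous_rightRegular_holds μ).restrict _ (continuous_archToAdelic (↥(maximalRealSubfield L)) L (IsCMField.complexConj L) N H)) νinf a ∘L
          (((cmDatum L N H).rightRegular μ).restrict (finAdelicToAdelic (↥(maximalRealSubfield L)) L (IsCMField.complexConj L) N H)).integratedOperator (((cmDatum L N H).isUnitary_rightRegular μ).restrict _) (((cmDatum L N H).isStronglyContinuous_rightRegular_holds μ).restrict _ (continuous_finAdelicToAdelic (↥(maximalRealSubfield L)) L (IsCMField.complexConj L) N H)) νf b})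
    (hTP : ∀ b j, Commute P (T b j))
    (hTB : ∀ b j, ∀ A' ∈ {A' : (cmDatum L N H).L2 μ →L[ℂ] (cmDatum L N H).L2 μ | ∃ (a : C_c(UnitaryGroup.arch (↥(maximalRealSubfield L)) L (IsCMField.complexConj L) N H, ℂ)) (b : C_c(finAdelic (↥(maximalRealSubfield L)) L (IsCMField.complexConj L) N H, ℂ)),
      A' = (((cmDatum L N H).rightRegular μ).restrict (archToAdelic (↥(maximalRealSubfield L)) L (IsCMField.complexConj L) N H)).integratedOperator (((cmDatum L N H).isUnitary_rightRegular μ).restrict _) (((cmDatum L N H).isStronglyContinuous_rightRegular_holds μ).restrict _ (continuous_archToAdelic (↥(maximalRealSubfield L)) L (IsCMField.complexConj L) N H)) νinf a ∘L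
          (((cmDatum L N H).rightRegular μ).restrict (finAdelicToAdelic (↥(maximalRealSubfield L)) L (IsCMField.complexConj L) N H)).integratedOperator (((cmDatum L N H).isUnitary_rightRegular μ).restrict _) (((cmDatum L N H).isStronglyContinuous_rightRegular_holds μ).restrict _ (continuous_finAdelicToAdelic (↥(maximalRealSubfield L)) L (IsCMField.complexConj L) N H)) νf b},
      ∀ x ∈ LinearMap.eqLocus (P : (cmDatum L N H).L2 μ →ₗ[ℂ] (cmDatum L N H).L2 μ) LinearMap.id, P (A' (T b j x)) = T b j (P (A' x)))
    (s : ∀ b, Jb b → Ω b → ℂ) (hs : ∀ b j, MemLp (s b j) ∞ (m b))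
    (hU : ∀ b j, ∀ v ∈ LinearMap.eqLocus (P : (cmDatum L N H).L2 μ →ₗ[ℂ] (cmDatum L N H).L2 μ) LinearMap.id,
      ((V b ∘ₗ (((Submodule.span ℂ (gen b)).topologicalClosure).starProjection : (cmDatum L N H).L2 μ →L[ℂ] (cmDatum L N H).L2 μ).toLinearMap) (T b j v)).2 = ((hs b j).toLp (s b j) • ((V b ∘ₗ (((Submodule.span ℂ (gen b)).topologicalClosure).starProjection : (cmDatum L N H).L2 μ →L[ℂ] (cmDatum L N H).L2 μ).toLinearMap) v).2 : Lp (E b) 2 (m b)))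
    (hline : ∀ b (c : Jb b → ℂ), m b {x | ∀ j, s b j x = c j} = 0) :
    ∃ (P' : (cmDatum L N H).L2 μ →L[ℂ] (cmDatum L N H).L2 μ) (A' : Submodule ℂ ((cmDatum L N H).L2 μ)), FiniteDimensional ℂ A' ∧
      (∀ x : (cmDatum L N H).L2 μ, (∀ u ∈ (⟨K', hK'o⟩ : OpenSubgroup (finAdelic (↥(maximalRealSubfield L)) L (IsCMField.complexConj L) N H)), ((cmDatum L N H).rightRegular μ) ((MonoidHom.id (cmDatum L N H).Adelic) ((finAdelicToAdelic (↥(maximalRealSubfield L)) L (IsCMField.complexConj L) N H) u)) x = x) →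
        (∀ t : K, ((cmDatum L N H).rightRegular μ) ((MonoidHom.id (cmDatum L N H).Adelic) (((archToAdelic (↥(maximalRealSubfield L)) L (IsCMField.complexConj L) N H).comp κ) t)) x = (1 : K →* ℂ) t • x) → P' x = x) ∧
      ∀ W : ClosedSubrep (((cmDatum L N H).rightRegular μ)), W.toContRep.IsTopIrreducible → W ≤ residualSubspace (cmDatum L N H) μ 𝔓 → ∀ w ∈ W, P' w ∈ A' :=
  hatoms_of_noLineMass (cmDatum L N H) μ 𝔓 (MonoidHom.id (cmDatum L N H).Adelic) ((archToAdelic (↥(maximalRealSubfield L)) L (IsCMField.complexConj L) N H).comp κ) (finAdelicToAdelic (↥(maximalRealSubfield L)) L (IsCMField.complexConj L) N H) (1 : K →* ℂ) ⟨K', hK'o⟩ P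
    (hPfix_trivialKType μ νf κ hκ μK χ e hχ1 K' hK'o he0 he1 P hPdef)
    (((cmDatum L N H).cuspidalSubspace μ 𝔓).toSubmoduleᗮ ⊓ ((((cmDatum L N H).rightRegular μ)).restrict (Subgroup.closure (Set.range (fun k : K => (archToAdelic (↥(maximalRealSubfield L)) L (IsCMField.complexConj L) N H) (κ k)) ∪ (finAdelicToAdelic (↥(maximalRealSubfield L)) L (IsCMField.complexConj L) N H) '' (K' : Set (finAdelic (↥(maximalRealSubfield L)) L (IsCMField.complexConj L) N H)))).subtype).invariants)
    (fun b => (V b ∘ₗ (((Submodule.span ℂ (gen b)).topologicalClosure).starProjection : (cmDatum L N H).L2 μ →L[ℂ] (cmDatum L N H).L2 μ).toLinearMap))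
    (hEXH_of_generators (cmDatum L N H) μ gen (((cmDatum L N H).cuspidalSubspace μ 𝔓).toSubmoduleᗮ ⊓ ((((cmDatum L N H).rightRegular μ)).restrict (Subgroup.closure (Set.range (fun k : K => (archToAdelic (↥(maximalRealSubfield L)) L (IsCMField.complexConj L) N H) (κ k)) ∪ (finAdelicToAdelic (↥(maximalRealSubfield L)) L (IsCMField.complexConj L) N H) '' (K' : Set (finAdelic (↥(maximalRealSubfield L)) L (IsCMField.complexConj L) N H)))).subtype).invariants) hC7 V hV)
    (hPEis_of_letters μ νf κ hκ μK χ e (hχmul_of_one χ hχ1) (hχ1 1) K' he0 he1 heK P hPdef 𝔓 (((cmDatum L N H).cuspidalSubspace μ 𝔓).toSubmoduleᗮ ⊓ ((((cmDatum L N H).rightRegular μ)).restrict (Subgroup.closure (Set.range (fun k : K => (archToAdelic (↥(maximalRealSubfield L)) L (IsCMField.complexConj L) N H) (κ k)) ∪ (finAdelicToAdelic (↥(maximalRealSubfield L)) L (IsCMField.complexConj L) N H) '' (K' : Set (finAdelic (↥(maximalRealSubfield L)) L (IsCMField.complexConj L) N H)))).subtype).invariants)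
      (hEisdef_of_trivial_kType μ νf κ hκ μK χ e hχ1 K' heK P hPdef 𝔓 (Subgroup.closure (Set.range (fun k : K => (archToAdelic (↥(maximalRealSubfield L)) L (IsCMField.complexConj L) N H) (κ k)) ∪ (finAdelicToAdelic (↥(maximalRealSubfield L)) L (IsCMField.complexConj L) N H) '' (K' : Set (finAdelic (↥(maximalRealSubfield L)) L (IsCMField.complexConj L) N H)))) le_rfl))
    (hD5_of_letters μ νinf νf κ hκ μK χ e m Jb (hχmul_of_one χ hχ1) (hχ1 1) (hχinv_of_one χ hχ1) K' he0 he1 heK hestar P hPdef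
      (fun b => (V b ∘ₗ (((Submodule.span ℂ (gen b)).topologicalClosure).starProjection : (cmDatum L N H).L2 μ →L[ℂ] (cmDatum L N H).L2 μ).toLinearMap)) T hT𝓐 hTP hTB s hs hU hline 𝔓)

end Summit.HodgeConjecture.HodgeConjecture.Cruxes.H413.K2E1ResidualAtomsMaximalLevelCMTwo

end
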